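import Literature.NumberTheory.Sieve.LargestPrimeFactorCubicCprimeRoots
import Literature.NumberTheory.Sieve.RoughNumbersCoprimeProgressions
import HarnessLib

/-!
# Heath-Brown 2001 (PLMS), (7.11): `#{a, b : (a,b)=1, n ∣ a³ − 2b³} ≤ #S · #rootsCube(n) · (M/n + 1)`

Topic `Literature/NumberTheory/Sieve`; a PROVED counting layer (no definitions, no named facts) under the
named fact `Irving2015_largestPrimeFactor_cubic` (`LargestPrimeFactorCubic.lean`), input of the tail
estimates (7.10)–(7.14) of **Lemma 7**.  Source: D. R. Heath-Brown, *The largest prime factor of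
`X³ + 2`*, Proc. London Math. Soc. (3) 82 (2001) 554–596, §7 p. 28: "if `f² ∣ a³ − 2b³` then `f` and `b`
must be coprime, since `a` and `b` are. Thus `a³ ≡ 2b³ (mod f²)` determines `O(f^ε)` values of `a` modulo
`f²` for each choice of `b`. It follows that `#{a, b : f² ∣ a³ − 2b³} ≪ N^ε M(1 + M f^{−2})`. (7.11)"
We prove it for an arbitrary modulus `n ≥ 1` (applied with `n = f², q₁², q₂²`), with the explicit root
count `#rootsCube n` in place of `O(n^ε)`:

* `card_filter_coprime_dvd_le` — for fixed `b`: `#{a ∈ (A, A+M] : (a,b)=1, n ∣ a³ − 2b³} ≤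
  #rootsCube(n) · (M/n + 1)` (the admissible `a` lie in the classes `a ≡ bk`, `k ∈ rootsCube n`);
* **`card_box_coprime_dvd_le`** — `#{(a,b) ∈ (A,A+M] × S : (a,b)=1, n ∣ a³ − 2b³} ≤ #S · #rootsCube(n) · (M/n + 1)`.

## References

* D. R. Heath-Brown, *The largest prime factor of `X³ + 2`*, Proc. London Math. Soc. (3) 82 (2001)
  554–596, §7 p. 28 (7.11). [`HeathBrown2001LargestPrimeFactorCubic`]

## Mathlib / tree search

Tree: `rootsCube`, `mem_rootsCube` (`…RootPairs`), `isCoprime_b_of_dvd`, `card_rootsCube_filter_eq_one`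
(`…CprimeRoots`), `RoughCoprimeAP.abs_card_Ioc_filter_modEq_sub_le` (`RoughNumbersCoprimeProgressions`).
Mathlib: `Finset.card_biUnion_le`, `Finset.card_le_card`, `Int.emod_emod_of_dvd`, `Nat.ModEq`.
-/

noncomputable section

open Finset

namespace Literature.NumberTheory.Sieve.HeathBrown2001

/-- For fixed `b`: `#{a ∈ (A, A+M] : (a,b) = 1, n ∣ a³ − 2b³} ≤ #rootsCube(n) · (M/n + 1)` (`n ≥ 1`).
[cite: HeathBrown2001LargestPrimeFactorCubic, §7 p. 28 (7.11)] -/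
theorem card_filter_coprime_dvd_le {n : ℕ} (hn : 0 < n) (A M b : ℕ) :
    (#((Ioc A (A + M)).filter fun a : ℕ => Nat.Coprime a b ∧ (n : ℤ) ∣ (a : ℤ) ^ 3 - 2 * (b : ℤ) ^ 3) : ℝ) ≤
      #(rootsCube n) * ((M : ℝ) / n + 1) := by
  classical
  -- cover by the classes `a ≡ b k (mod n)`, `k ∈ rootsCube n`
  have hcover : ((Ioc A (A + M)).filter fun a : ℕ => Nat.Coprime a b ∧ (n : ℤ) ∣ (a : ℤ) ^ 3 - 2 * (b : ℤ) ^ 3) ⊆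
      (rootsCube n).biUnion fun k => (Ioc A (A + M)).filter fun a : ℕ => a ≡ (b * k) % n [MOD n] := by
    intro a ha
    rw [mem_filter] at ha
    obtain ⟨haI, hab, hdvd⟩ := ha
    -- the unique root class
    have h1 := card_rootsCube_filter_eq_one hn hab hdvd
    obtain ⟨k, hk⟩ := card_eq_one.mp h1
    have hkmem : k ∈ (rootsCube n).filter fun k : ℕ => (n : ℤ) ∣ (a : ℤ) - b * k := by rw [hk]; exact mem_singleton_self k
    rw [mem_filter] at hkmem
    rw [mem_biUnion]
    refine ⟨k, hkmem.1, ?_⟩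
    rw [mem_filter]
    refine ⟨haI, ?_⟩
    -- `n ∣ a − bk` ⇒ `a ≡ bk (mod n)`
    have h3 : a ≡ b * k [MOD n] := Nat.modEq_iff_dvd.mpr (by
      push_cast
      rw [show (b : ℤ) * k - a = -((a : ℤ) - b * k) by ring, dvd_neg]
      exact hkmem.2)
    exact h3.trans (Nat.mod_modEq _ _).symm
  calc (#((Ioc A (A + M)).filter fun a : ℕ => Nat.Coprime a b ∧ (n : ℤ) ∣ (a : ℤ) ^ 3 - 2 * (b : ℤ) ^ 3) : ℝ)
      ≤ #((rootsCube n).biUnion fun k => (Ioc A (A + M)).filter fun a : ℕ => a ≡ (b * k) % n [MOD n]) := by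
        exact_mod_cast card_le_card hcover
    _ ≤ ∑ k ∈ rootsCube n, (#((Ioc A (A + M)).filter fun a : ℕ => a ≡ (b * k) % n [MOD n]) : ℝ) := by
        exact_mod_cast card_biUnion_le
    _ ≤ ∑ _k ∈ rootsCube n, ((M : ℝ) / n + 1) := by
        refine sum_le_sum fun k _ => ?_
        have h := BFI.abs_card_Ioc_filter_modEq_sub_le hn ((b * k) % n) (Nat.le_add_right A M)
        rw [Nat.cast_add, add_sub_cancel_left] at h
        linarith [(abs_le.mp h).2]
    _ = #(rootsCube n) * ((M : ℝ) / n + 1) := by rw [sum_const, nsmul_eq_mul]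

/-- **(7.11)**: `#{(a,b) ∈ (A,A+M] × S : (a,b) = 1, n ∣ a³ − 2b³} ≤ #S · #rootsCube(n) · (M/n + 1)` (`n ≥ 1`).
[cite: HeathBrown2001LargestPrimeFactorCubic, §7 p. 28 (7.11)] -/
theorem card_box_coprime_dvd_le {n : ℕ} (hn : 0 < n) (A M : ℕ) (S : Finset ℕ) :
    (#((Ioc A (A + M) ×ˢ S).filter fun ab : ℕ × ℕ =>
        Nat.Coprime ab.1 ab.2 ∧ (n : ℤ) ∣ (ab.1 : ℤ) ^ 3 - 2 * (ab.2 : ℤ) ^ 3) : ℝ) ≤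
      #S * (#(rootsCube n) * ((M : ℝ) / n + 1)) := by
  classical
  -- fibre over `b`
  have h1 : #((Ioc A (A + M) ×ˢ S).filter fun ab : ℕ × ℕ =>
        Nat.Coprime ab.1 ab.2 ∧ (n : ℤ) ∣ (ab.1 : ℤ) ^ 3 - 2 * (ab.2 : ℤ) ^ 3) =
      ∑ b ∈ S, #((Ioc A (A + M)).filter fun a : ℕ => Nat.Coprime a b ∧ (n : ℤ) ∣ (a : ℤ) ^ 3 - 2 * (b : ℤ) ^ 3) := by
    rw [card_filter, sum_product_right]
    refine sum_congr rfl fun b _ => ?_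
    rw [card_filter]
  rw [h1]
  push_cast
  calc ∑ b ∈ S, (#((Ioc A (A + M)).filter fun a : ℕ => Nat.Coprime a b ∧ (n : ℤ) ∣ (a : ℤ) ^ 3 - 2 * (b : ℤ) ^ 3) : ℝ)
      ≤ ∑ _b ∈ S, (#(rootsCube n) * ((M : ℝ) / n + 1)) := sum_le_sum fun b _ => card_filter_coprime_dvd_le hn A M b
    _ = #S * (#(rootsCube n) * ((M : ℝ) / n + 1)) := by rw [sum_const, nsmul_eq_mul]

end Literature.NumberTheory.Sieve.HeathBrown2001
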